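import Summits.CriticalPhenomena.CardyFormulaZ2.Theorems.CardySusyWardParafermionFamiliesToSLESixTouchLowerBoundF
import Literature.Topology.PlaneTopology.JordanCurveProofs

/-!
# Touch lower bound on diagonal free walls (stub `stub_touchLowerBound`, reshape r2, of the line
# `exact-potential-schwarz-christoffel`, crux stmt-CriticalPhenomena-10814), G: the one-sided box, and the local
# touch lower bound under the stub's own hypotheses

* `exists_oneSidedBox`: for a DIAGONAL-rectilinear Dobrushin domain `P` and an open window `W` meeting the free arc
  `P.arc 1` with `closure W` off the wired arc, there are signs `a, b = ±1` and a box
  `{|a x - b y - t₀| < wτ, |a x + b y - c| < wν} ⊆ W` whose open lower half `{c - wν < a x + b y < c}` lies in `P` and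
  whose open upper half `{c < a x + b y < c + wν}` misses `P`. Proof: take the flat piece of part F; discard the
  finitely many columns where a non-collinear side crosses its line and shrink around a remaining point, so that in
  the box the frontier lies on the line and the line lies on the frontier; the two open half-boxes are convex, hence
  each lies in `P` or in the exterior `(closure P)ᶜ`; the centre is a limit of points of `P` (one half is in `P`)
  and — Jordan curve theorem, `JordanDomain.frontier_subset_closure_exterior JordanCurveTheorem_holds` — of exterior
  points (the other half is outside); flip the signs if needed.
* `touchLowerBound_local_of_window` (registered sub-goal): the LOCAL touch lower bound `touchLowerBound_local` of the
  main file under EXACTLY the hypotheses of `stub_touchLowerBound` (`IsDiagRectilinear P` unfolded, `IsFamily P Λ`,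
  `W` open, `Disjoint (closure W) (P.arc 0)`, `(W ∩ P.arc 1).Nonempty`): eventually in `δ`,
  `m ≤ δ^{2/3} Σ_{touch sites x, mesh point in W} P(x ↔ distance ≥ η by (Λ δ).bcBondConfig-open edges)`.
  What separates this from the stub is the GLUING of the far end of the arm to the discrete wired arc `zdArcA`
  (uniformly in `δ`), stated as a Lean signature in the reply to the lead.
-/

noncomputable section

namespace Summit.CriticalPhenomena.CardyFormulaZ2.Theorems.ParafermionFamiliesToSLESix.TouchLowerBound

open Set Metric Complex Filter MeasureTheory
open scoped Topology
open Literature.Probability.LatticeModels Literature.Probability.Percolation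
open Literature.Probability.RandomPlanarGeometry
open Literature.Topology.PlaneTopology (JordanCurveTheorem_holds)
open Summit.CriticalPhenomena.CardyFormulaZ2.Theorems.ParafermionPrecompact.Negative (IsFamily)

/-! ## Geometry of the line `{x + b y = c}` -/

/-- Along a segment the level `x + b y` is affine in the parameter. [folklore] -/
theorem level_lineMap (b : ℤ) (z₁ z₂ : ℂ) (θ : ℝ) :
    (z₁ + θ • (z₂ - z₁)).re + b * (z₁ + θ • (z₂ - z₁)).im =
      (z₁.re + b * z₁.im) + θ * ((z₂.re + b * z₂.im) - (z₁.re + b * z₁.im)) := by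
  simp only [add_re, add_im, Complex.real_smul, mul_re, mul_im, ofReal_re, ofReal_im, sub_re, sub_im, zero_mul,
    sub_zero, add_zero]
  ring

/-- A segment with both endpoints on the line lies on the line. [folklore] -/
theorem level_eq_of_mem_segment {b : ℤ} {c : ℝ} {z₁ z₂ z : ℂ} (h₁ : z₁.re + b * z₁.im = c) (h₂ : z₂.re + b * z₂.im = c)
    (hz : z ∈ segment ℝ z₁ z₂) : z.re + b * z.im = c := by
  rw [segment_eq_image'] at hz
  obtain ⟨θ, -, rfl⟩ := hz
  rw [level_lineMap]
  linear_combination (1 - θ) * h₁ + θ * h₂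

/-- A segment NOT lying on the line meets it in at most one point. [folklore] -/
theorem subsingleton_segment_inter_line {b : ℤ} {c : ℝ} {z₁ z₂ : ℂ}
    (h : ¬ (z₁.re + b * z₁.im = c ∧ z₂.re + b * z₂.im = c)) :
    (segment ℝ z₁ z₂ ∩ {z : ℂ | z.re + b * z.im = c}).Subsingleton := by
  rintro z ⟨hz, hzc⟩ w ⟨hw, hwc⟩
  rw [segment_eq_image'] at hz hw
  obtain ⟨θ, -, rfl⟩ := hz
  obtain ⟨θ', -, rfl⟩ := hw
  rw [mem_setOf_eq] at hzc hwc
  dsimp only at hzc hwc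
  rw [level_lineMap] at hzc hwc
  by_cases hΔ : (z₂.re + b * z₂.im) - (z₁.re + b * z₁.im) = 0
  · exfalso
    rw [hΔ, mul_zero, add_zero] at hzc
    exact h ⟨hzc, by linarith⟩
  · have e : θ * ((z₂.re + b * z₂.im) - (z₁.re + b * z₁.im)) = θ' * ((z₂.re + b * z₂.im) - (z₁.re + b * z₁.im)) := by
      linarith
    rw [mul_right_cancel₀ hΔ e]

/-- The level and the column separate points by at most twice their distance (`a = 1`). [folklore] -/
theorem abs_level_col_sub_le (b : ℤ) (hb : b = 1 ∨ b = -1) (p q : ℂ) :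
    |(p.re + b * p.im) - (q.re + b * q.im)| ≤ 2 * dist p q ∧ |(p.re - b * p.im) - (q.re - b * q.im)| ≤ 2 * dist p q := by
  have h1 := abs_level_sub_le (a := 1) (b := b) (Or.inl rfl) hb p q
  have h2 := abs_level_sub_le (a := 1) (b := -b) (Or.inl rfl) (by rcases hb with rfl | rfl <;> simp) p q
  push_cast at h1 h2
  simp only [one_mul, neg_mul, ← sub_eq_add_neg] at h1 h2
  exact ⟨h1, h2⟩

/-- The open half-boxes `{|column - t₀| < w, N₁ < level < N₂}` are convex. [folklore] -/
theorem convex_halfBox (b : ℤ) (t₀ w N₁ N₂ : ℝ) :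
    Convex ℝ {z : ℂ | |z.re - b * z.im - t₀| < w ∧ N₁ < z.re + b * z.im ∧ z.re + b * z.im < N₂} := by
  have hτ : IsLinearMap ℝ fun z : ℂ => z.re - (b : ℝ) * z.im :=
    { map_add := fun x y => by simp only [add_re, add_im]; ring
      map_smul := fun r x => by simp only [Complex.real_smul, mul_re, mul_im, ofReal_re, ofReal_im, zero_mul, sub_zero,
        add_zero, smul_eq_mul]; ring }
  have hν : IsLinearMap ℝ fun z : ℂ => z.re + (b : ℝ) * z.im :=
    { map_add := fun x y => by simp only [add_re, add_im]; ring
      map_smul := fun r x => by simp only [Complex.real_smul, mul_re, mul_im, ofReal_re, ofReal_im, zero_mul, sub_zero,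
        add_zero, smul_eq_mul]; ring }
  have e : {z : ℂ | |z.re - b * z.im - t₀| < w ∧ N₁ < z.re + b * z.im ∧ z.re + b * z.im < N₂} =
      ({z : ℂ | z.re - (b : ℝ) * z.im < t₀ + w} ∩ {z : ℂ | t₀ - w < z.re - (b : ℝ) * z.im}) ∩
        ({z : ℂ | N₁ < z.re + (b : ℝ) * z.im} ∩ {z : ℂ | z.re + (b : ℝ) * z.im < N₂}) := by
    ext z; simp only [mem_setOf_eq, mem_inter_iff, abs_lt]; constructor
    · rintro ⟨⟨h1, h2⟩, h3, h4⟩; exact ⟨⟨by linarith, by linarith⟩, h3, h4⟩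
    · rintro ⟨⟨h1, h2⟩, h3, h4⟩; exact ⟨⟨by linarith, by linarith⟩, h3, h4⟩
  rw [e]
  exact ((convex_halfSpace_lt hτ _).inter (convex_halfSpace_gt hτ _)).inter
    ((convex_halfSpace_gt hν _).inter (convex_halfSpace_lt hν _))

/-- A preconnected set off the frontier of an open set lies inside it or inside its exterior. [folklore] -/
theorem subset_or_subset_of_frontier {Ω T : Set ℂ} (hΩ : IsOpen Ω) (hT : IsPreconnected T)
    (h : ∀ z ∈ T, z ∉ frontier Ω) : T ⊆ Ω ∨ T ⊆ (closure Ω)ᶜ := by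
  refine hT.subset_or_subset hΩ isClosed_closure.isOpen_compl ?_ fun z hz => ?_
  · exact Set.disjoint_left.2 fun z hz hz' => hz' (subset_closure hz)
  · by_cases hc : z ∈ closure Ω
    · left
      by_contra hzΩ
      exact h z hz ⟨hc, by rwa [hΩ.interior_eq]⟩
    · exact Or.inr hc

/-! ## The one-sided box -/

/-- **The one-sided box at a flat diagonal piece of the free arc.** See the module docstring. [folklore] -/
theorem exists_oneSidedBox (P : DobrushinDomain)
    (hdiag : ∃ S : Finset (ℂ × ℂ), (∀ p ∈ S, (p.1 - p.2).re = (p.1 - p.2).im ∨ (p.1 - p.2).re = -(p.1 - p.2).im) ∧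
      frontier P.carrier ⊆ ⋃ p ∈ S, segment ℝ p.1 p.2)
    {W : Set ℂ} (hWo : IsOpen W) (hW : Disjoint (closure W) (P.arc 0)) (hne : (W ∩ P.arc 1).Nonempty) :
    ∃ (a b : ℤ) (c t₀ wτ wν : ℝ), (a = 1 ∨ a = -1) ∧ (b = 1 ∨ b = -1) ∧ 0 < wτ ∧ 0 < wν ∧
      (∀ z : ℂ, |a * z.re - b * z.im - t₀| < wτ → |a * z.re + b * z.im - c| < wν → z ∈ W) ∧
      (∀ z : ℂ, |a * z.re - b * z.im - t₀| < wτ → c - wν < a * z.re + b * z.im → a * z.re + b * z.im < c →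
        z ∈ P.carrier) ∧
      (∀ z : ℂ, |a * z.re - b * z.im - t₀| < wτ → c < a * z.re + b * z.im → a * z.re + b * z.im < c + wν →
        z ∉ P.carrier) := by
  classical
  obtain ⟨S, -, hfront⟩ := id hdiag
  obtain ⟨b, c, T₁, T₂, hb, hT, hline⟩ := exists_flat_piece P hdiag hWo hW hne
  have hb2 : (b : ℝ) * b = 1 := by rcases hb with rfl | rfl <;> norm_num
  have hPo : IsOpen P.carrier := P.isOpen
  -- Step 6: the non-collinear sides and their (finitely many) crossing columns
  set T : Set (ℂ × ℂ) := {s | s ∈ S ∧ ¬ (s.1.re + b * s.1.im = c ∧ s.2.re + b * s.2.im = c)} with hT_def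
  have hTf : T.Finite := S.finite_toSet.subset fun s hs => hs.1
  set U : Set ℂ := ⋃ s ∈ T, segment ℝ s.1 s.2 with hU
  have hUc : IsClosed U := hTf.isClosed_biUnion fun s _ => (isCompact_segment_complex _ _).isClosed
  set Bad : Set ℝ := ⋃ s ∈ T, (fun z : ℂ => z.re - b * z.im) '' (segment ℝ s.1 s.2 ∩ {z : ℂ | z.re + b * z.im = c})
    with hBad
  have hBadf : Bad.Finite :=
    hTf.biUnion fun s hs => ((subsingleton_segment_inter_line hs.2).finite.image _)
  obtain ⟨t, ht, htBad⟩ := (Ioo_infinite hT).exists_notMem_finite hBadf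
  -- the point of the line with column `t`
  set q : ℂ := ⟨(c + t) / 2, b * (c - t) / 2⟩ with hq
  have hνq : q.re + b * q.im = c := by
    show (c + t) / 2 + b * (b * (c - t) / 2) = c
    linear_combination ((c - t) / 2) * hb2
  have hτq : q.re - b * q.im = t := by
    show (c + t) / 2 - b * (b * (c - t) / 2) = t
    linear_combination (-(c - t) / 2) * hb2
  obtain ⟨hqW, hqf⟩ := hline q hνq (by rw [hτq]; exact ht.1.le) (by rw [hτq]; exact ht.2.le)
  have hqU : q ∉ U := by
    intro h
    rw [hU, mem_iUnion₂] at h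
    obtain ⟨s, hs, hmem⟩ := h
    apply htBad
    rw [hBad, mem_iUnion₂]
    exact ⟨s, hs, q, ⟨hmem, hνq⟩, hτq⟩
  obtain ⟨r₁, hr₁, hr₁U⟩ := Metric.isOpen_iff.1 hUc.isOpen_compl q hqU
  obtain ⟨r₂, hr₂, hr₂W⟩ := Metric.isOpen_iff.1 hWo q hqW
  set w : ℝ := min (min r₁ r₂ / 4) (min (t - T₁) (T₂ - t)) with hw_def
  have hw : 0 < w := by
    have := ht.1; have := ht.2
    positivity
  have hw₁ : 4 * w ≤ r₁ := by
    have := (min_le_left _ _ : w ≤ min r₁ r₂ / 4); have := min_le_left r₁ r₂; linarith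
  have hw₂ : 4 * w ≤ r₂ := by
    have := (min_le_left _ _ : w ≤ min r₁ r₂ / 4); have := min_le_right r₁ r₂; linarith
  have hw₃ : w ≤ t - T₁ := (min_le_right _ _).trans (min_le_left _ _)
  have hw₄ : w ≤ T₂ - t := (min_le_right _ _).trans (min_le_right _ _)
  -- the box lies in the two balls
  have hdist : ∀ z : ℂ, |z.re - b * z.im - t| < w → |z.re + b * z.im - c| < w → dist z q < 2 * w := by
    intro z h1 h2
    rw [← hτq] at h1
    rw [← hνq] at h2
    rw [Complex.dist_eq]
    refine lt_of_le_of_lt (Complex.norm_le_abs_re_add_abs_im _) ?_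
    simp only [sub_re, sub_im]
    rw [abs_lt] at h1 h2
    obtain ⟨h1l, h1r⟩ := h1
    obtain ⟨h2l, h2r⟩ := h2
    rcases hb with rfl | rfl <;> push_cast at h1l h1r h2l h2r <;>
      cases abs_cases (z.re - q.re) <;> cases abs_cases (z.im - q.im) <;> linarith
  have hboxW : ∀ z : ℂ, |z.re - b * z.im - t| < w → |z.re + b * z.im - c| < w → z ∈ W := fun z h1 h2 =>
    hr₂W (mem_ball.2 (by linarith [hdist z h1 h2]))
  -- Step 7: in the box the frontier lies on the line
  have hfl : ∀ z : ℂ, |z.re - b * z.im - t| < w → |z.re + b * z.im - c| < w → z ∈ frontier P.carrier →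
      z.re + b * z.im = c := by
    intro z h1 h2 hz
    have hz' := hfront hz
    rw [mem_iUnion₂] at hz'
    obtain ⟨s, hs, hzs⟩ := hz'
    by_cases hcol : s.1.re + b * s.1.im = c ∧ s.2.re + b * s.2.im = c
    · exact level_eq_of_mem_segment hcol.1 hcol.2 hzs
    · exfalso
      have hzU : z ∈ U := by rw [hU, mem_iUnion₂]; exact ⟨s, ⟨hs, hcol⟩, hzs⟩
      exact hr₁U (mem_ball.2 (by linarith [hdist z h1 h2])) hzU
  -- Step 8: in the box the line lies on the frontier
  have hlf : ∀ z : ℂ, |z.re - b * z.im - t| < w → z.re + b * z.im = c → z ∈ frontier P.carrier := by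
    intro z h1 h2
    rw [abs_lt] at h1
    exact (hline z h2 (by linarith) (by linarith)).2
  -- Step 9: the two half-boxes
  set Rm : Set ℂ := {z : ℂ | |z.re - b * z.im - t| < w ∧ c - w < z.re + b * z.im ∧ z.re + b * z.im < c} with hRm
  set Rp : Set ℂ := {z : ℂ | |z.re - b * z.im - t| < w ∧ c < z.re + b * z.im ∧ z.re + b * z.im < c + w} with hRp
  have hRm_side : Rm ⊆ P.carrier ∨ Rm ⊆ (closure P.carrier)ᶜ :=
    subset_or_subset_of_frontier hPo (convex_halfBox b t w (c - w) c).isPreconnected fun z hz hzf => by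
      have := hfl z hz.1 (by rw [abs_lt]; constructor <;> linarith [hz.2.1, hz.2.2]) hzf
      linarith [hz.2.2]
  have hRp_side : Rp ⊆ P.carrier ∨ Rp ⊆ (closure P.carrier)ᶜ :=
    subset_or_subset_of_frontier hPo (convex_halfBox b t w c (c + w)).isPreconnected fun z hz hzf => by
      have := hfl z hz.1 (by rw [abs_lt]; constructor <;> linarith [hz.2.1, hz.2.2]) hzf
      linarith [hz.2.1]
  -- a nearby point `z` off the line lies in `Rm ∪ Rp`
  have hnear : ∀ z : ℂ, dist z q < w / 2 → z.re + b * z.im ≠ c → z ∈ Rm ∨ z ∈ Rp := by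
    intro z hzd hzc
    obtain ⟨e1, e2⟩ := abs_level_col_sub_le b hb z q
    rw [hνq] at e1
    rw [hτq] at e2
    have h1 : |z.re - b * z.im - t| < w := lt_of_le_of_lt e2 (by linarith)
    rw [abs_le] at e1
    rcases lt_or_gt_of_ne hzc with h | h
    · exact Or.inl ⟨h1, by linarith [e1.1], h⟩
    · exact Or.inr ⟨h1, h, by linarith [e1.2]⟩
  -- a point of `P` near `q`
  obtain ⟨p', hp'P, hp'd⟩ := Metric.mem_closure_iff.1 (frontier_subset_closure hqf) (w / 2) (by positivity)
  have hp'c : p'.re + b * p'.im ≠ c := fun h => by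
    obtain ⟨-, e2⟩ := abs_level_col_sub_le b hb p' q
    rw [hτq, dist_comm] at e2
    have hf := hlf p' (lt_of_le_of_lt e2 (by linarith)) h
    rw [frontier, hPo.interior_eq] at hf
    exact hf.2 hp'P
  -- an exterior point near `q` (Jordan curve theorem)
  have hqe : q ∈ closure (closure P.carrier)ᶜ := P.toJordanDomain.frontier_subset_closure_exterior JordanCurveTheorem_holds hqf
  obtain ⟨e, heE, hed⟩ := Metric.mem_closure_iff.1 hqe (w / 2) (by positivity)
  have hec : e.re + b * e.im ≠ c := fun h => by
    obtain ⟨-, e2⟩ := abs_level_col_sub_le b hb e q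
    rw [hτq, dist_comm] at e2
    have hf := hlf e (lt_of_le_of_lt e2 (by linarith)) h
    exact heE (frontier_subset_closure hf)
  have hp'side := hnear p' (by rwa [dist_comm]) hp'c
  have heside := hnear e (by rwa [dist_comm]) hec
  have hp'cl : p' ∈ closure P.carrier := subset_closure hp'P
  have heP : e ∉ P.carrier := fun h => heE (subset_closure h)
  -- which half is in `P`
  have hside : (Rm ⊆ P.carrier ∧ Rp ⊆ (closure P.carrier)ᶜ) ∨ (Rp ⊆ P.carrier ∧ Rm ⊆ (closure P.carrier)ᶜ) := by
    rcases hp'side with hp' | hp'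
    · have hm : Rm ⊆ P.carrier := hRm_side.resolve_right fun h => h hp' hp'cl
      refine Or.inl ⟨hm, hRp_side.resolve_left fun h => ?_⟩
      rcases heside with he | he
      · exact heP (hm he)
      · exact heP (h he)
    · have hp : Rp ⊆ P.carrier := hRp_side.resolve_right fun h => h hp' hp'cl
      refine Or.inr ⟨hp, hRm_side.resolve_left fun h => ?_⟩
      rcases heside with he | he
      · exact heP (h he)
      · exact heP (hp he)
  -- Step 10: output
  rcases hside with ⟨h1, h2⟩ | ⟨h1, h2⟩
  · refine ⟨1, b, c, t, w, w, Or.inl rfl, hb, hw, hw, fun z hτ hν => ?_, fun z hτ hν₁ hν₂ => ?_, fun z hτ hν₁ hν₂ hz => ?_⟩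
    · push_cast at hτ hν; rw [one_mul] at hτ hν; exact hboxW z hτ hν
    · push_cast at hτ hν₁ hν₂; rw [one_mul] at hτ hν₁ hν₂; exact h1 ⟨hτ, hν₁, hν₂⟩
    · push_cast at hτ hν₁ hν₂; rw [one_mul] at hτ hν₁ hν₂; exact h2 ⟨hτ, hν₁, hν₂⟩ (subset_closure hz)
  · refine ⟨-1, -b, -c, -t, w, w, Or.inr rfl, by rcases hb with rfl | rfl <;> simp, hw, hw, fun z hτ hν => ?_,
      fun z hτ hν₁ hν₂ => ?_, fun z hτ hν₁ hν₂ hz => ?_⟩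
    · push_cast at hτ hν
      refine hboxW z ?_ ?_
      · rw [show z.re - b * z.im - t = -((-1) * z.re - -(b : ℝ) * z.im - -t) by ring, abs_neg]; exact hτ
      · rw [show z.re + b * z.im - c = -((-1) * z.re + -(b : ℝ) * z.im - -c) by ring, abs_neg]; exact hν
    · push_cast at hτ hν₁ hν₂
      refine h1 ⟨?_, by linarith, by linarith⟩
      rw [show z.re - b * z.im - t = -((-1) * z.re - -(b : ℝ) * z.im - -t) by ring, abs_neg]; exact hτ
    · push_cast at hτ hν₁ hν₂
      refine h2 ⟨?_, by linarith, by linarith⟩ (subset_closure hz)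
      rw [show z.re - b * z.im - t = -((-1) * z.re - -(b : ℝ) * z.im - -t) by ring, abs_neg]; exact hτ

/-! ## The local touch lower bound under the stub's hypotheses -/

/-- **The LOCAL touch lower bound under the hypotheses of `stub_touchLowerBound`** (registered sub-goal
`touchLowerBound_local_of_window`; `exists_oneSidedBox` + `touchLowerBound_local`). See the module docstring.
[cite: Nolin2008, §4.3, proof of Prop. 12 (i) (arXiv 0711.4948: Prop. 11), with §4.6] -/
theorem touchLowerBound_local_of_window : ∀ (P : DobrushinDomain), (∃ S : Finset (ℂ × ℂ), (∀ p ∈ S, (p.1 - p.2).re = (p.1 - p.2).im ∨ (p.1 - p.2).re = -(p.1 - p.2).im) ∧ frontier P.carrier ⊆ ⋃ p ∈ S, segment ℝ p.1 p.2) → ∀ (Λ : ℝ → DiscreteDobrushin), IsFamily P Λ → ∀ W : Set ℂ, IsOpen W → Disjoint (closure W) (P.arc 0) → (W ∩ P.arc 1).Nonempty → ∃ η > (0:ℝ), ∃ m > (0:ℝ), ∀ᶠ δ in 𝓝[>] (0:ℝ), m ≤ δ ^ ((2:ℝ) / 3) * ∑ᶠ x : Site 2, Set.indicator {x : Site 2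 | x ∉ (Λ δ).zdArcA ∧ x ∉ (Λ δ).zdArcB ∧ (∃ y ∈ (Λ δ).zdArcB, s(x, y) ∈ (discreteDomainGraph (Λ δ).Ω (Λ δ).δ).edgeSet) ∧ meshPoint (Λ δ).δ x ∈ W} (fun x => (bondPercolation (zdGraph 2) half).real {ω | ∃ z : Site 2, η ≤ dist (meshPoint δ z) (meshPoint δ x) ∧ (openGraph ((Λ δ).bcBondConfig ω)).Reachable x z}) x := by
  intro P hdiag Λ hΛ W hWo hW hne
  obtain ⟨a, b, c, t₀, wτ, wν, ha, hb, hwτ, hwν, hRW, hin, hout⟩ := exists_oneSidedBox P hdiag hWo hW hne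
  exact touchLowerBound_local P Λ hΛ W hW a b c t₀ wτ wν ha hb hwτ hwν hRW hin hout

end Summit.CriticalPhenomena.CardyFormulaZ2.Theorems.ParafermionFamiliesToSLESix.TouchLowerBound

end
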